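import Literature.NumberTheory.Automorphic.AutomorphicGaloisConj
import Literature.NumberTheory.Automorphic.AutomorphicLFunction
import Literature.NumberTheory.Automorphic.AdelicGroupDataUniquenessProofs
import HarnessLib

/-!
# Cuspidal automorphic representations do not depend on the normalisation of the automorphic
# measure: transport along `μ' = c • μ`

Topic `NumberTheory/Automorphic`; namespace `Literature.NumberTheory.Automorphic`. The tree's
cuspidal automorphic representations of `GL_n(𝔸_K)` are closed irreducible invariant subspaces of
`L²_cusp(GL_n(K) A_G \ GL_n(𝔸_K), μ)` for an *automorphic measure* `μ` (`IsAutomorphicMeasure`: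
finite, positive on opens, inner regular, invariant), a class which pins `μ` down only up to a
positive scalar (`AdelicGroupData.isAutomorphicMeasure_unique_smul_holds`: `μ' = c • μ`, `c ≠ 0`;
Borel (1963), §5; Getz–Hahn (2024), Thm. 3.2.2). Statements quantified over two cuspidal
representations on the same `GL_n` with respect to two automorphic measures `μ`, `μ'` (e.g.
`JacquetShalika1981_partialPairL_boundary_of_ne_one` at ranks `(n, n)`) therefore need the
(mathematically empty) remark that "`π` is a cuspidal automorphic representation with Satake
parameters `t_{π,v}`" does not depend on the normalisation of the measure (Borel–Jacquet (1979),
§4.6: the space of cusp forms and the Hecke operators are defined without reference to it). This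
file proves that remark in the tree's model:

* `changeMeasureLp` / `changeMeasureLpEquiv` — for `c ≠ 0, ∞` the identity on functions is a
  continuous linear equivalence `L^p(c • μ) ≃L[ℂ] L^p(μ)` (same null sets, `‖·‖` scaled by
  `c^{-1/p}`), commuting with the regular representation of `GL_n(𝔸_K)`
  (`changeMeasureLp_rightRegular`, `isConjEquivariant_changeMeasureLpEquiv` with `θ = 1`);
* `ContRepresentation.ClosedSubrep.changeMeasure`, `CuspidalAutomorphicRepGL.changeMeasure` — the
  transported closed subrepresentation / cuspidal automorphic representation (cusp forms for
  `c • μ` are cusp forms for `μ`, `changeMeasureLp_mem_cuspidalSubspace`; irreducibility by the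
  generic `isTopIrreducible_mapConj_iff` of `AutomorphicGaloisConj`);
* `HasSatakeParameterAt.changeMeasure`, `IsSatakeFamilyOf.changeMeasure` — Satake parameters and
  Satake families are unchanged (the Hecke operators commute with the transport,
  `heckeOperatorAt_mapConj_mapConjEquiv` with `θ = 1`);
* `CuspidalAutomorphicRepGL.exists_changeMeasure_isSatakeFamilyOf` — **for any two automorphic
  measures `μ`, `μ'` on `GL_n(K) A_G \ GL_n(𝔸_K)` and every cuspidal `π'` with respect to `μ'` there
  is a cuspidal `π''` with respect to `μ` with the same Satake families** (the form consumed by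
  two-measure statements).

## References

* A. Borel, H. Jacquet, *Automorphic forms and automorphic representations*, Proc. Sympos. Pure
  Math. 33 (1979), part 1, §4.6. [BorelJacquetCorvallis1979]
* A. Borel, *Some finiteness properties of adele groups over number fields*, Publ. Math. IHÉS 16
  (1963), §5. [Borel1963]
-/

noncomputable section

open scoped ENNReal NNReal Topology
open MeasureTheory Filter NumberField IsDedekindDomain

namespace Literature.NumberTheory.Automorphic

/-! ### `L^p(c • μ) ≃ L^p(μ)`: the identity on functions -/

section ChangeOfMeasure

variable {X : Type*} [MeasurableSpace X] {E : Type*} [NormedAddCommGroup E]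
  {p : ℝ≥0∞} {μ : Measure X} {c : ℝ≥0∞}

/-- `c⁻¹ • (c • μ) = μ` for `c ≠ 0, ∞`. [folklore] -/
theorem inv_smul_smul_measure (hc0 : c ≠ 0) (hc : c ≠ ∞) (μ : Measure X) : c⁻¹ • (c • μ) = μ := by
  rw [smul_smul, ENNReal.inv_mul_cancel hc0 hc, one_smul]

/-- `MemLp f p (c • μ) ↔ MemLp f p μ` for `c ≠ 0, ∞`. [folklore] -/
theorem memLp_smul_measure_iff_of_ne_zero (hc0 : c ≠ 0) (hc : c ≠ ∞) {f : X → E} :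
    MemLp f p (c • μ) ↔ MemLp f p μ := by
  refine ⟨fun h => ?_, fun h => h.smul_measure hc⟩
  have h' := h.smul_measure (c := c⁻¹) (ENNReal.inv_ne_top.mpr hc0)
  rwa [inv_smul_smul_measure hc0 hc] at h'

omit [NormedAddCommGroup E] in
/-- a.e. equalities transfer from `c • μ` to `μ` (`c ≠ 0`). [folklore] -/
theorem ae_eq_of_ae_eq_smul_measure (hc0 : c ≠ 0) {f g : X → E} (h : f =ᵐ[c • μ] g) :
    f =ᵐ[μ] g := by
  have h' : ∀ᵐ x ∂(c • μ), f x = g x := h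
  rw [Measure.ae_ennreal_smul_measure_iff hc0] at h'
  exact h'

omit [NormedAddCommGroup E] in
/-- a.e. equalities transfer from `μ` to `c • μ`. [folklore] -/
theorem ae_eq_smul_measure_of_ae_eq (c : ℝ≥0∞) {f g : X → E} (h : f =ᵐ[μ] g) :
    f =ᵐ[c • μ] g :=
  Measure.ae_smul_measure h c

/-- **The identity on functions `L^p(c • μ) → L^p(μ)`** (`c ≠ 0, ∞`): the class of a representative.
[folklore] -/
def changeMeasureLp (hc0 : c ≠ 0) (hc : c ≠ ∞) (f : Lp E p (c • μ)) : Lp E p μ :=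
  ((memLp_smul_measure_iff_of_ne_zero hc0 hc).mp (Lp.memLp f)).toLp f

/-- **The identity on functions `L^p(μ) → L^p(c • μ)`** (`c ≠ ∞`). [folklore] -/
def changeMeasureLpInv (hc : c ≠ ∞) (f : Lp E p μ) : Lp E p (c • μ) :=
  ((Lp.memLp f).smul_measure hc).toLp f

/-- `changeMeasureLp f = f` a.e. [folklore] -/
theorem coeFn_changeMeasureLp (hc0 : c ≠ 0) (hc : c ≠ ∞) (f : Lp E p (c • μ)) :
    (changeMeasureLp hc0 hc f : X → E) =ᵐ[μ] f :=
  MemLp.coeFn_toLp _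

/-- `changeMeasureLpInv f = f` a.e. [folklore] -/
theorem coeFn_changeMeasureLpInv (hc : c ≠ ∞) (f : Lp E p μ) :
    (changeMeasureLpInv (μ := μ) hc f : X → E) =ᵐ[c • μ] f :=
  MemLp.coeFn_toLp _

/-- On classes of functions: `changeMeasureLp [φ]_{c • μ} = [φ]_μ`. [folklore] -/
theorem changeMeasureLp_toLp (hc0 : c ≠ 0) (hc : c ≠ ∞) {φ : X → E} (hφ : MemLp φ p (c • μ)) :
    changeMeasureLp hc0 hc (hφ.toLp φ) =
      ((memLp_smul_measure_iff_of_ne_zero hc0 hc).mp hφ).toLp φ := by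
  apply Lp.ext
  refine (coeFn_changeMeasureLp hc0 hc _).trans ?_
  exact (ae_eq_of_ae_eq_smul_measure hc0 hφ.coeFn_toLp).trans (MemLp.coeFn_toLp _).symm

/-- `changeMeasureLpInv ∘ changeMeasureLp = id`. [folklore] -/
theorem changeMeasureLpInv_changeMeasureLp (hc0 : c ≠ 0) (hc : c ≠ ∞) (f : Lp E p (c • μ)) :
    changeMeasureLpInv hc (changeMeasureLp hc0 hc f) = f := by
  apply Lp.ext
  refine (coeFn_changeMeasureLpInv hc _).trans ?_
  exact ae_eq_smul_measure_of_ae_eq c (coeFn_changeMeasureLp hc0 hc f)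

/-- `changeMeasureLp ∘ changeMeasureLpInv = id`. [folklore] -/
theorem changeMeasureLp_changeMeasureLpInv (hc0 : c ≠ 0) (hc : c ≠ ∞) (f : Lp E p μ) :
    changeMeasureLp hc0 hc (changeMeasureLpInv hc f) = f := by
  apply Lp.ext
  refine (coeFn_changeMeasureLp hc0 hc _).trans ?_
  exact ae_eq_of_ae_eq_smul_measure hc0 (coeFn_changeMeasureLpInv hc f)

/-- `changeMeasureLp` is additive. [folklore] -/
theorem changeMeasureLp_add (hc0 : c ≠ 0) (hc : c ≠ ∞) (f g : Lp E p (c • μ)) :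
    changeMeasureLp hc0 hc (f + g) = changeMeasureLp hc0 hc f + changeMeasureLp hc0 hc g := by
  apply Lp.ext
  refine (coeFn_changeMeasureLp hc0 hc _).trans ?_
  refine EventuallyEq.trans ?_ (Lp.coeFn_add _ _).symm
  exact (ae_eq_of_ae_eq_smul_measure hc0 (Lp.coeFn_add f g)).trans
    ((coeFn_changeMeasureLp hc0 hc f).add (coeFn_changeMeasureLp hc0 hc g)).symm

/-- `changeMeasureLpInv` is additive. [folklore] -/
theorem changeMeasureLpInv_add (hc : c ≠ ∞) (f g : Lp E p μ) :
    changeMeasureLpInv hc (f + g) = changeMeasureLpInv hc f + changeMeasureLpInv (c := c) hc g := by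
  apply Lp.ext
  refine (coeFn_changeMeasureLpInv hc _).trans ?_
  refine EventuallyEq.trans ?_ (Lp.coeFn_add _ _).symm
  exact (ae_eq_smul_measure_of_ae_eq c (Lp.coeFn_add f g)).trans
    ((coeFn_changeMeasureLpInv hc f).add (coeFn_changeMeasureLpInv hc g)).symm

/-- **Norms scale by `c^{-1/p}`**: `‖changeMeasureLp f‖ = (c⁻¹)^{1/p} ‖f‖`. [folklore] -/
theorem norm_changeMeasureLp (hc0 : c ≠ 0) (hc : c ≠ ∞) (f : Lp E p (c • μ)) :
    ‖changeMeasureLp hc0 hc f‖ = (c⁻¹ ^ (1 / p).toReal).toReal * ‖f‖ := by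
  rw [Lp.norm_def, Lp.norm_def, eLpNorm_congr_ae (coeFn_changeMeasureLp hc0 hc f)]
  have h : ∀ g : X → E, eLpNorm g p μ = c⁻¹ ^ (1 / p).toReal * eLpNorm g p (c • μ) := by
    intro g
    conv_lhs => rw [← inv_smul_smul_measure hc0 hc μ]
    rw [eLpNorm_smul_measure_of_ne_zero (ENNReal.inv_ne_zero.mpr hc), smul_eq_mul]
  rw [h, ENNReal.toReal_mul]

/-- `‖changeMeasureLpInv f‖ = c^{1/p} ‖f‖`. [folklore] -/
theorem norm_changeMeasureLpInv (hc0 : c ≠ 0) (hc : c ≠ ∞) (f : Lp E p μ) :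
    ‖changeMeasureLpInv (c := c) hc f‖ = (c ^ (1 / p).toReal).toReal * ‖f‖ := by
  rw [Lp.norm_def, Lp.norm_def, eLpNorm_congr_ae (coeFn_changeMeasureLpInv hc f),
    eLpNorm_smul_measure_of_ne_zero hc0, smul_eq_mul, ENNReal.toReal_mul]

variable [NormedSpace ℂ E]

/-- `changeMeasureLp` is `ℂ`-homogeneous. [folklore] -/
theorem changeMeasureLp_smul (hc0 : c ≠ 0) (hc : c ≠ ∞) (a : ℂ) (f : Lp E p (c • μ)) :
    changeMeasureLp hc0 hc (a • f) = a • changeMeasureLp hc0 hc f := by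
  apply Lp.ext
  refine (coeFn_changeMeasureLp hc0 hc _).trans ?_
  refine EventuallyEq.trans ?_ (Lp.coeFn_smul _ _).symm
  exact (ae_eq_of_ae_eq_smul_measure hc0 (Lp.coeFn_smul a f)).trans
    ((coeFn_changeMeasureLp hc0 hc f).const_smul a).symm

/-- `changeMeasureLpInv` is `ℂ`-homogeneous. [folklore] -/
theorem changeMeasureLpInv_smul (hc : c ≠ ∞) (a : ℂ) (f : Lp E p μ) :
    changeMeasureLpInv hc (a • f) = a • changeMeasureLpInv (c := c) hc f := by
  apply Lp.ext
  refine (coeFn_changeMeasureLpInv hc _).trans ?_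
  refine EventuallyEq.trans ?_ (Lp.coeFn_smul _ _).symm
  exact (ae_eq_smul_measure_of_ae_eq c (Lp.coeFn_smul a f)).trans
    ((coeFn_changeMeasureLpInv hc f).const_smul a).symm

variable [Fact (1 ≤ p)]

/-- `changeMeasureLp` as a continuous linear map. [folklore] -/
def changeMeasureLpL (hc0 : c ≠ 0) (hc : c ≠ ∞) : Lp E p (c • μ) →L[ℂ] Lp E p μ :=
  LinearMap.mkContinuous
    { toFun := changeMeasureLp hc0 hc
      map_add' := changeMeasureLp_add hc0 hc
      map_smul' := changeMeasureLp_smul hc0 hc }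
    ((c⁻¹ ^ (1 / p).toReal).toReal) fun f => (norm_changeMeasureLp hc0 hc f).le

/-- `changeMeasureLpInv` as a continuous linear map. [folklore] -/
def changeMeasureLpInvL (hc0 : c ≠ 0) (hc : c ≠ ∞) : Lp E p μ →L[ℂ] Lp E p (c • μ) :=
  LinearMap.mkContinuous
    { toFun := changeMeasureLpInv hc
      map_add' := changeMeasureLpInv_add hc
      map_smul' := changeMeasureLpInv_smul hc }
    ((c ^ (1 / p).toReal).toReal) fun f => (norm_changeMeasureLpInv hc0 hc f).le

/-- **`L^p(c • μ) ≃L[ℂ] L^p(μ)`, the identity on functions** (`c ≠ 0, ∞`). [folklore] -/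
def changeMeasureLpEquiv (hc0 : c ≠ 0) (hc : c ≠ ∞) : Lp E p (c • μ) ≃L[ℂ] Lp E p μ :=
  ContinuousLinearEquiv.equivOfInverse (changeMeasureLpL hc0 hc) (changeMeasureLpInvL hc0 hc)
    (changeMeasureLpInv_changeMeasureLp hc0 hc) (changeMeasureLp_changeMeasureLpInv hc0 hc)

/-- `changeMeasureLpEquiv` is `changeMeasureLp` as a function (definitional). [folklore] -/
@[simp]
theorem changeMeasureLpEquiv_apply (hc0 : c ≠ 0) (hc : c ≠ ∞) (f : Lp E p (c • μ)) :
    changeMeasureLpEquiv hc0 hc f = changeMeasureLp hc0 hc f := rfl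

/-- The inverse of `changeMeasureLpEquiv` is `changeMeasureLpInv` (definitional). [folklore] -/
@[simp]
theorem changeMeasureLpEquiv_symm_apply (hc0 : c ≠ 0) (hc : c ≠ ∞) (f : Lp E p μ) :
    (changeMeasureLpEquiv (μ := μ) hc0 hc).symm f = changeMeasureLpInv hc f := rfl

end ChangeOfMeasure

/-! ### The transport commutes with the regular representation of `GL_n(𝔸_K)` -/

section Regular

open AdelicGroupData

variable {n : ℕ} {K : Type} [Field K] [NumberField K] {μ : Measure (gl n K).automorphicQuotient}
  {c : ℝ≥0∞} [SMulInvariantMeasure (gl n K).Adelic (gl n K).automorphicQuotient μ]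
  [SMulInvariantMeasure (gl n K).Adelic (gl n K).automorphicQuotient (c • μ)]

/-- **`changeMeasureLp` intertwines the regular representations** on `L²(c • μ)` and `L²(μ)`:
both act by `f ↦ f (g⁻¹ • ·)` on functions. [folklore] -/
theorem changeMeasureLp_rightRegular (hc0 : c ≠ 0) (hc : c ≠ ∞) (g : (gl n K).Adelic)
    (f : (gl n K).L2 (c • μ)) :
    changeMeasureLp hc0 hc ((gl n K).rightRegular (c • μ) g f) =
      (gl n K).rightRegular μ g (changeMeasureLp hc0 hc f) := by
  apply Lp.ext
  have h1 := coeFn_changeMeasureLp hc0 hc ((gl n K).rightRegular (c • μ) g f)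
  have h2 : ((gl n K).rightRegular (c • μ) g f : (gl n K).automorphicQuotient → ℂ) =ᵐ[μ]
      fun x => f (g⁻¹ • x) :=
    ae_eq_of_ae_eq_smul_measure hc0 ((gl n K).rightRegular_apply_coeFn (c • μ) g f)
  have h3 := (gl n K).rightRegular_apply_coeFn μ g (changeMeasureLp hc0 hc f)
  have h4 : (fun x => (changeMeasureLp hc0 hc f : (gl n K).automorphicQuotient → ℂ) (g⁻¹ • x)) =ᵐ[μ]
      fun x => f (g⁻¹ • x) := by
    have h0 : (changeMeasureLp hc0 hc f : (gl n K).automorphicQuotient → ℂ)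
        =ᵐ[μ.map fun x : (gl n K).automorphicQuotient => g⁻¹ • x] fun y => f y := by
      rw [(measurePreserving_smul g⁻¹ μ).map_eq]
      exact coeFn_changeMeasureLp hc0 hc f
    exact ae_eq_comp (measurable_const_smul g⁻¹).aemeasurable h0
  exact h1.trans (h2.trans (h3.trans h4).symm)

/-- `changeMeasureLpEquiv` is (`1`-conjugate) equivariant for the regular representations
(`IsConjEquivariant` with `θ = MulEquiv.refl`). [folklore] -/
theorem isConjEquivariant_changeMeasureLpEquiv (hc0 : c ≠ 0) (hc : c ≠ ∞) :
    ContRepresentation.ClosedSubrep.IsConjEquivariant ((gl n K).rightRegular (c • μ))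
      ((gl n K).rightRegular μ)
      (changeMeasureLpEquiv hc0 hc : (gl n K).L2 (c • μ) ≃L[ℂ] (gl n K).L2 μ)
      (MulEquiv.refl (gl n K).Adelic) :=
  fun g f => changeMeasureLp_rightRegular hc0 hc g f

/-- **The transport of a closed subrepresentation `W ≤ L²(c • μ)` to `L²(μ)`** (the same
functions). [folklore] -/
def _root_.ContRepresentation.ClosedSubrep.changeMeasure
    (W : ContRepresentation.ClosedSubrep ((gl n K).rightRegular (c • μ))) (hc0 : c ≠ 0)
    (hc : c ≠ ∞) : ContRepresentation.ClosedSubrep ((gl n K).rightRegular μ) :=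
  W.mapConj (isConjEquivariant_changeMeasureLpEquiv hc0 hc)

/-- `changeMeasureLp f ∈ W.changeMeasure ↔ f ∈ W`. [folklore] -/
theorem _root_.ContRepresentation.ClosedSubrep.changeMeasureLp_mem_changeMeasure_iff
    (W : ContRepresentation.ClosedSubrep ((gl n K).rightRegular (c • μ))) (hc0 : c ≠ 0)
    (hc : c ≠ ∞) {f : (gl n K).L2 (c • μ)} :
    changeMeasureLp hc0 hc f ∈ W.changeMeasure hc0 hc ↔ f ∈ W :=
  W.apply_mem_mapConj_iff _

/-- `f ∈ W.changeMeasure ↔ changeMeasureLpInv f ∈ W`. [folklore] -/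
theorem _root_.ContRepresentation.ClosedSubrep.mem_changeMeasure_iff
    (W : ContRepresentation.ClosedSubrep ((gl n K).rightRegular (c • μ))) (hc0 : c ≠ 0)
    (hc : c ≠ ∞) {f : (gl n K).L2 μ} :
    f ∈ W.changeMeasure hc0 hc ↔ changeMeasureLpInv hc f ∈ W :=
  W.mem_mapConj_iff _

/-- **`W.changeMeasure` is irreducible iff `W` is.** [folklore] -/
theorem _root_.ContRepresentation.ClosedSubrep.isTopIrreducible_changeMeasure_iff
    (W : ContRepresentation.ClosedSubrep ((gl n K).rightRegular (c • μ))) (hc0 : c ≠ 0)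
    (hc : c ≠ ∞) :
    (W.changeMeasure hc0 hc).toContRep.IsTopIrreducible ↔ W.toContRep.IsTopIrreducible :=
  W.isTopIrreducible_mapConj_iff _

end Regular

/-! ### Cusp forms and cuspidal automorphic representations -/

section CuspForms

open AdelicGroupData

variable {n : ℕ} {K : Type} [Field K] [NumberField K] {μ : Measure (gl n K).automorphicQuotient}
  {c : ℝ≥0∞}

/-- **Cusp forms do not see the normalisation**: `φ ∈ cuspForms (c • μ) ↔ φ ∈ cuspForms μ`
(continuity and vanishing of constant terms do not involve `μ`; square-integrability transfers).
[folklore] -/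
theorem mem_cuspForms_smul_measure_iff (hc0 : c ≠ 0) (hc : c ≠ ∞)
    {φ : (gl n K).automorphicQuotient → ℂ} : φ ∈ cuspForms n K (c • μ) ↔ φ ∈ cuspForms n K μ := by
  simp only [mem_cuspForms_iff, IsContinuousCuspForm, memLp_smul_measure_iff_of_ne_zero hc0 hc]

/-- `changeMeasureLp` maps the image of `cuspForms` in `L²(c • μ)` into the image of `cuspForms` in
`L²(μ)`: `[φ]_{c • μ} ↦ [φ]_μ`. [folklore] -/
theorem changeMeasureLp_mem_range_cuspFormsToLp (hc0 : c ≠ 0) (hc : c ≠ ∞)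
    {f : (gl n K).L2 (c • μ)} (hf : f ∈ LinearMap.range (cuspFormsToLp n K (c • μ))) :
    changeMeasureLp hc0 hc f ∈ LinearMap.range (cuspFormsToLp n K μ) := by
  obtain ⟨φ, rfl⟩ := hf
  refine ⟨⟨(φ : (gl n K).automorphicQuotient → ℂ), (mem_cuspForms_smul_measure_iff hc0 hc).mp φ.2⟩,
    ?_⟩
  rw [cuspFormsToLp_apply, cuspFormsToLp_apply, changeMeasureLp_toLp]

variable [SMulInvariantMeasure (gl n K).Adelic (gl n K).automorphicQuotient μ]
  [SMulInvariantMeasure (gl n K).Adelic (gl n K).automorphicQuotient (c • μ)]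

/-- **`changeMeasureLp` maps `L²_cusp(c • μ)` into `L²_cusp(μ)`** (it maps the image of the cusp
forms into the image of the cusp forms and is continuous). [folklore] -/
theorem changeMeasureLp_mem_cuspidalSubspace (hc0 : c ≠ 0) (hc : c ≠ ∞) {f : (gl n K).L2 (c • μ)}
    (hf : f ∈ cuspidalSubspace n K (c • μ)) : changeMeasureLp hc0 hc f ∈ cuspidalSubspace n K μ := by
  have hmaps : Set.MapsTo (changeMeasureLp hc0 hc)
      (LinearMap.range (cuspFormsToLp n K (c • μ)) : Set ((gl n K).L2 (c • μ)))
      (LinearMap.range (cuspFormsToLp n K μ) : Set ((gl n K).L2 μ)) :=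
    fun f hf => changeMeasureLp_mem_range_cuspFormsToLp hc0 hc hf
  have hcl := hmaps.closure (changeMeasureLpL (E := ℂ) (p := 2) (μ := μ) hc0 hc).continuous
  have hf' : f ∈ closure (LinearMap.range (cuspFormsToLp n K (c • μ)) : Set ((gl n K).L2 (c • μ))) := by
    rw [← Submodule.topologicalClosure_coe]
    exact hf
  have := hcl hf'
  rw [← Submodule.topologicalClosure_coe] at this
  exact this

/-- **The transport of a subrepresentation of `L²_cusp(c • μ)` lies in `L²_cusp(μ)`.** [folklore] -/
theorem changeMeasure_le_cuspidalSubspace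
    {W : ContRepresentation.ClosedSubrep ((gl n K).rightRegular (c • μ))}
    (hW : W ≤ cuspidalSubspace n K (c • μ)) (hc0 : c ≠ 0) (hc : c ≠ ∞) :
    W.changeMeasure hc0 hc ≤ cuspidalSubspace n K μ := by
  intro f hf
  rw [ContRepresentation.ClosedSubrep.mem_changeMeasure_iff] at hf
  have := changeMeasureLp_mem_cuspidalSubspace hc0 hc (hW hf)
  rwa [changeMeasureLp_changeMeasureLpInv] at this

/-- **A cuspidal automorphic representation with respect to `c • μ` is one with respect to `μ`**
(same functions: the transport `W.changeMeasure`, cuspidal by `changeMeasure_le_cuspidalSubspace`,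
irreducible by `isTopIrreducible_changeMeasure_iff`). Borel–Jacquet (1979), §4.6.
[cite: BorelJacquetCorvallis1979, §4.6] -/
def CuspidalAutomorphicRepGL.changeMeasure (P : CuspidalAutomorphicRepGL n K (c • μ)) (hc0 : c ≠ 0)
    (hc : c ≠ ∞) : CuspidalAutomorphicRepGL n K μ :=
  ⟨P.1.changeMeasure hc0 hc, changeMeasure_le_cuspidalSubspace P.2.1 hc0 hc,
    (P.1.isTopIrreducible_changeMeasure_iff hc0 hc).mpr P.2.2⟩

/-- The underlying closed subrepresentation of `P.changeMeasure` (definitional). [folklore] -/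
@[simp]
theorem CuspidalAutomorphicRepGL.changeMeasure_val (P : CuspidalAutomorphicRepGL n K (c • μ))
    (hc0 : c ≠ 0) (hc : c ≠ ∞) : (P.changeMeasure hc0 hc).1 = P.1.changeMeasure hc0 hc := rfl

end CuspForms

/-! ### Satake parameters are unchanged -/

section Satake

open AdelicGroupData

variable {n : ℕ} {K : Type} [Field K] [NumberField K] {μ : Measure (gl n K).automorphicQuotient}
  {c : ℝ≥0∞} [SMulInvariantMeasure (gl n K).Adelic (gl n K).automorphicQuotient μ]
  [SMulInvariantMeasure (gl n K).Adelic (gl n K).automorphicQuotient (c • μ)]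

/-- `Kf.map (MulEquiv.refl _) = Kf`. [folklore] -/
theorem subgroup_map_mulEquiv_refl {G : Type*} [Group G] (Kf : Subgroup G) :
    Kf.map (MulEquiv.refl G).toMonoidHom = Kf := by
  ext x
  simp

/-- **Satake parameters of the transport**: `W` has Satake parameter `α` at `v` (level `Kf`,
uniformizer `ϖ`) iff... in the direction needed: if `W ≤ L²(c • μ)` has it, so does
`W.changeMeasure ≤ L²(μ)` — the transport carries the `Kf`-fixed Hecke eigenvector to a `Kf`-fixed
vector on which the Hecke operators `[Kf t_{v,i} Kf]` act by the same scalars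
(`heckeOperatorAt_mapConj_mapConjEquiv` with `θ = 1`). [folklore] -/
theorem HasSatakeParameterAt.changeMeasure
    {W : ContRepresentation.ClosedSubrep ((gl n K).rightRegular (c • μ))}
    {Kf : Subgroup (gl n K).Adelic} {v : HeightOneSpectrum (𝓞 K)} {ϖ : (v.adicCompletion K)ˣ}
    {α : Multiset ℂ} (h : HasSatakeParameterAt W Kf v ϖ α) (hc0 : c ≠ 0) (hc : c ≠ ∞) :
    HasSatakeParameterAt (W.changeMeasure hc0 hc) Kf v ϖ α := by
  obtain ⟨hϖ, hcard, f, hf, hf0, hT⟩ := h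
  have he := isConjEquivariant_changeMeasureLpEquiv (μ := μ) hc0 hc
  have hfix := (W.mapConjEquiv_mem_fixedVectors_iff he Kf f).mpr hf
  rw [subgroup_map_mulEquiv_refl] at hfix
  refine ⟨hϖ, hcard, W.mapConjEquiv he f, hfix, ?_, fun i hi => ?_⟩
  · exact fun h0 => hf0 ((W.mapConjEquiv he).injective (h0.trans (map_zero _).symm))
  · have key := heckeOperatorAt_mapConj_mapConjEquiv W he Kf (heckeDiagAt n K v ϖ i) hf
    rw [subgroup_map_mulEquiv_refl] at key
    refine key.trans ?_
    rw [hT i hi, map_smul]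
    rfl

end Satake

section SatakeFamily

open AdelicGroupData

variable {n : ℕ} {K : Type} [Field K] [NumberField K] {μ : Measure (gl n K).automorphicQuotient}
  {c : ℝ≥0∞} [(gl n K).IsAutomorphicMeasure μ] [(gl n K).IsAutomorphicMeasure (c • μ)]

/-- **Satake families of the transport**: a Satake family of `π` (w.r.t. `c • μ`) away from `S` is
a Satake family of `π.changeMeasure` (w.r.t. `μ`) away from `S`. [folklore] -/
theorem IsSatakeFamilyOf.changeMeasure {P : CuspidalAutomorphicRepGL n K (c • μ)}
    {S : Set (HeightOneSpectrum (𝓞 K))} {α : SatakeFamily K} (h : IsSatakeFamilyOf P S α)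
    (hc0 : c ≠ 0) (hc : c ≠ ∞) : IsSatakeFamilyOf (P.changeMeasure hc0 hc) S α := by
  intro v hv
  obtain ⟨𝔫, h𝔫, hv𝔫, ϖ, hα⟩ := h v hv
  exact ⟨𝔫, h𝔫, hv𝔫, ϖ, hα.changeMeasure hc0 hc⟩

end SatakeFamily

/-! ### Two automorphic measures on the same quotient -/

section TwoMeasures

open AdelicGroupData

variable {n : ℕ} {K : Type} [Field K] [NumberField K]

/-- **Cuspidal automorphic representations for two automorphic measures.** For automorphic measures
`μ`, `μ'` on `GL_n(K) A_G \ GL_n(𝔸_K)` (so `μ' = c • μ`, `c ≠ 0`, by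
`isAutomorphicMeasure_unique_smul_holds`) and a cuspidal `π'` with respect to `μ'`, there is a
cuspidal `π''` with respect to `μ` (the same functions) with the same Satake families away from
every `S`. Borel–Jacquet (1979), §4.6; Borel (1963), §5. [cite: BorelJacquetCorvallis1979, §4.6] -/
theorem CuspidalAutomorphicRepGL.exists_changeMeasure_isSatakeFamilyOf
    (μ μ' : Measure (gl n K).automorphicQuotient) [(gl n K).IsAutomorphicMeasure μ]
    [(gl n K).IsAutomorphicMeasure μ'] (P' : CuspidalAutomorphicRepGL n K μ') :
    ∃ P'' : CuspidalAutomorphicRepGL n K μ, ∀ (S : Set (HeightOneSpectrum (𝓞 K)))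
      (α : SatakeFamily K), IsSatakeFamilyOf P' S α → IsSatakeFamilyOf P'' S α := by
  obtain ⟨c, hc0, hμ'⟩ := isAutomorphicMeasure_unique_smul_holds n K μ' μ
  rw [← Measure.coe_nnreal_smul] at hμ'
  subst hμ'
  exact ⟨P'.changeMeasure (ENNReal.coe_ne_zero.mpr hc0) ENNReal.coe_ne_top,
    fun S α h => h.changeMeasure _ _⟩

end TwoMeasures

end Literature.NumberTheory.Automorphic

end
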